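import Summits.MatrixMultiplication.MatrixMultiplication.Theorems.SoloInformedSelfSimilarVacuous

/-!
# No exact two-term certificate: `⟨a⟩ ⊠ T_cw,2^{⊠n} ⊕ ⟨c⟩ ⋭ T_cw,2^{⊠(n+1)}` whenever `a·3^n + c = 3^{n+1}`

Solo seat `solo-MatrixMultiplication-informed` (generation 38); fifth file of the slice-rank series
(`SoloInformedSliceRank`, `…SliceTransfer`, `…KroneckerCatalystVacuous`, `…SelfSimilarVacuous`).
The general structured door `asymptoticRank_pow_succ_le_of_poly_certificate`
(`SoloInformedKroneckerCatalyst.lean`) turns ONE degeneration `⟨a⟩ ⊠ t^{⊠n} ⊕ ⟨c⟩ ⊵ t^{⊠(n+1)}` into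
`R̃(t)^{n+1} ≤ a R̃(t)^n + c`.  For `t = T_cw,2` such a certificate gives `R̃(T_cw,2) = 3` ON THE NOSE
(hence `ω = 2`, door D11) exactly when its largest root is `3`, i.e. when the two first index sets have
the same size: `a·3^n + c = 3^{n+1}`.

**Theorem** (`not_algDegeneratesTo_exactCertificate_cwTensor_two`, every field): in that equal-format
case the degeneration does not exist, for any `n, a, c`.  If `c ≥ 1` the source has a coordinate slice
of rank `1` (a unit summand) while every non-zero slice of the target has rank `≥ 2^{n+1} ≥ 2`
(transfer lemma); if `c = 0` then `a = 3` and this is the self-similar case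
(`not_algDegeneratesTo_selfSimilar_cwTensor_two`).  So exact structured certificates for `σ(T_cw,2) = 3`
do not exist at any level; only certificates with format slack (`a·3^n + c > 3^{n+1}`, strict bounds
`ω < ω₀`) remain conceivable, as recorded for doors D1, D10, D11.

HONEST FRAMING: nothing here bears on the truth of `ω = 2`; it removes a certificate SHAPE.

[cite: Landsberg2017, Prop. 5.2.1.2]
[cite: BurgisserClausenShokrollahi1997, (15.19)]
[cite: ChristandlVranaZuiddam2023, §1.1]
-/

set_option linter.dupNamespace false
set_option linter.unusedSectionVars false

noncomputable section

namespace Summit.MatrixMultiplication.MatrixMultiplication.Theorems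

open Literature.Computability.AlgebraicComplexity
open scoped BigOperators Matrix

namespace SliceRank

variable {K : Type*} [Field K]

section UnitSummand

variable {ι κ μ : Type*} [Fintype ι] [Fintype κ] [Fintype μ] [DecidableEq ι] [DecidableEq κ]
  [DecidableEq μ]

/-- In `u ⊕ ⟨c⟩` the coordinate slice at a unit index `inr i` has the single non-zero column `inr i`.
[cite: ChristandlVranaZuiddam2023, §1.1] -/
theorem directSum_unitTensor_inr_apply_eq_zero (u : ι → κ → μ → K) (c : ℕ) (i : Fin c)
    (bb : κ ⊕ Fin c) {cc : μ ⊕ Fin c} (hcc : cc ≠ Sum.inr i) :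
    directSumTensor u (unitTensor K c) (Sum.inr i) bb cc = 0 := by
  rcases cc with c' | c'
  · rcases bb with b | b
    · exact directSumTensor_inr_inl _ _ _ _ _
    · rfl
  · rcases bb with b | b
    · exact directSumTensor_inr_inl _ _ _ _ _
    · rw [directSumTensor_inr, unitTensor_apply, if_neg]
      rintro ⟨rfl, rfl⟩
      exact hcc rfl

/-- **A unit summand gives a slice of rank `≤ 1`**: the coordinate slice of `u ⊕ ⟨c⟩` at the unit
index `inr i` has rank `≤ 1`. [cite: BurgisserClausenShokrollahi1997, (14.17)] -/
theorem rank_coordSlice_directSum_unitTensor_le_one (u : ι → κ → μ → K) (c : ℕ) (i : Fin c) :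
    (slice (directSumTensor u (unitTensor K c))
      (fun x => if x = Sum.inr i then (1 : K) else 0)).rank ≤ 1 := by
  classical
  set v := directSumTensor u (unitTensor K c) with hv
  have hsl : slice v (fun x => if x = Sum.inr i then (1 : K) else 0) =
      Matrix.of fun bb cc => v (Sum.inr i) bb cc := by
    ext bb cc
    rw [slice_apply, Matrix.of_apply, Finset.sum_eq_single (Sum.inr i : ι ⊕ Fin c)
      (fun x _ hx => by simp [hx]) (by simp)]
    simp
  rw [hsl]
  calc (Matrix.of fun bb cc => v (Sum.inr i) bb cc).rank
      ≤ ({(Sum.inr i : μ ⊕ Fin c)} : Finset (μ ⊕ Fin c)).card :=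
        rank_le_card_of_cols _ _ fun cc hcc bb => by
          rw [Matrix.of_apply, hv]
          exact directSum_unitTensor_inr_apply_eq_zero u c i bb
            (by simpa [Finset.mem_singleton] using hcc)
    _ = 1 := Finset.card_singleton _

end UnitSummand

end SliceRank

/-! ## The theorem -/

section ExactCertificate

open SliceRank

variable {K : Type*} [Field K]

/-- **No exact two-term certificate (every field).**  If `a·3^n + c = 3^{n+1}` (the certificate's
largest root would be exactly `3`, i.e. it would give `σ(T_cw,2) = 3` on the nose) then
`⟨a⟩ ⊠ T_cw,2^{⊠n} ⊕ ⟨c⟩ ⋭ T_cw,2^{⊠(n+1)}`: for `c ≥ 1` a unit summand is a slice of rank `1 < 2^{n+1}`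
(transfer lemma), for `c = 0` it is the self-similar case `a = 3`.
[cite: Landsberg2017, Prop. 5.2.1.2] [cite: BurgisserClausenShokrollahi1997, (15.19)] -/
theorem not_algDegeneratesTo_exactCertificate_cwTensor_two (n a c : ℕ)
    (h : a * 3 ^ n + c = 3 ^ (n + 1)) :
    ¬ AlgDegeneratesTo
        (directSumTensor (kroneckerTensor (unitTensor K a) (kroneckerPow (cwTensor K 2) n))
          (unitTensor K c))
        (kroneckerPow (cwTensor K 2) (n + 1)) := by
  classical
  rcases Nat.eq_zero_or_pos c with hc | hc
  · -- `c = 0`: then `a = 3`, the self-similar case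
    subst hc
    have ha : a = 3 := by
      have h3 : 0 < 3 ^ n := pow_pos (by norm_num) n
      rw [add_zero, pow_succ, mul_comm (3 ^ n) 3] at h
      exact Nat.eq_of_mul_eq_mul_right h3 h
    subst ha
    exact not_algDegeneratesTo_selfSimilar_cwTensor_two n
  · -- `c ≥ 1`: a unit summand is a slice of rank `1`
    intro hdeg
    have ht := minSliceRank_kroneckerPow_cwTensor_two (K := K) (n + 1)
    set i₀ : Fin c := ⟨0, hc⟩
    have hα₀ : (fun x : (Fin a × (Fin n → Fin 3)) ⊕ Fin c =>
        if x = Sum.inr i₀ then (1 : K) else 0) ≠ 0 := fun h0 =>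
      (one_ne_zero : (1 : K) ≠ 0) (by simpa using congr_fun h0 (Sum.inr i₀))
    have hsrc : (slice (directSumTensor (kroneckerTensor (unitTensor K a)
        (kroneckerPow (cwTensor K 2) n)) (unitTensor K c))
        (fun x => if x = Sum.inr i₀ then (1 : K) else 0)).rank < 2 ^ (n + 1) := by
      have h1 := rank_coordSlice_directSum_unitTensor_le_one
        (kroneckerTensor (unitTensor K a) (kroneckerPow (cwTensor K 2) n)) c i₀
      have h2 : 1 < 2 ^ (n + 1) := Nat.one_lt_two_pow (Nat.succ_ne_zero n)
      exact h1.trans_lt h2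
    have hcard : Fintype.card (Fin (n + 1) → Fin 3) =
        Fintype.card ((Fin a × (Fin n → Fin 3)) ⊕ Fin c) := by
      simp [Fintype.card_sum, Fintype.card_prod, Fintype.card_fin, ← h]
    exact not_algDegeneratesTo_of_minSliceRank ht (Fintype.equivOfCardEq hcard) hα₀ hsrc hdeg

/-- Over `ℂ`: the exact instances of the structured door
`asymptoticRank_pow_succ_le_of_poly_certificate` for `T_cw,2` (those with `a·3^n + c = 3^{n+1}`, the
only ones giving `R̃(T_cw,2) ≤ 3`) have an unsatisfiable hypothesis. [cite: Landsberg2017, Prop. 5.2.1.2] -/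
theorem exactCertificate_door_vacuous :
    ¬ ∃ n a c : ℕ, a * 3 ^ n + c = 3 ^ (n + 1) ∧ AlgDegeneratesTo
        (directSumTensor (kroneckerTensor (unitTensor ℂ a) (kroneckerPow (cwTensor ℂ 2) n))
          (unitTensor ℂ c))
        (kroneckerPow (cwTensor ℂ 2) (n + 1)) :=
  fun ⟨n, a, c, h, hdeg⟩ => not_algDegeneratesTo_exactCertificate_cwTensor_two n a c h hdeg

/-- Contrapositive bookkeeping: a two-term certificate `⟨a⟩ ⊠ T_cw,2^{⊠n} ⊕ ⟨c⟩ ⊵ T_cw,2^{⊠(n+1)}`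
that exists has `a·3^n + c ≠ 3^{n+1}` (format slack is forced; with the flattening lower bound
`a·3^n + c ≥ 3^{n+1}` of the door file this means STRICT excess). [cite: Landsberg2017, Prop. 5.2.1.2] -/
theorem format_ne_of_certificate_cwTensor_two {n a c : ℕ}
    (hdeg : AlgDegeneratesTo
        (directSumTensor (kroneckerTensor (unitTensor K a) (kroneckerPow (cwTensor K 2) n))
          (unitTensor K c))
        (kroneckerPow (cwTensor K 2) (n + 1))) :
    a * 3 ^ n + c ≠ 3 ^ (n + 1) := fun h =>
  not_algDegeneratesTo_exactCertificate_cwTensor_two n a c h hdeg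

end ExactCertificate

end Summit.MatrixMultiplication.MatrixMultiplication.Theorems

end
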